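import Mathlib.NumberTheory.Zsqrtd.Basic
import Mathlib.Data.ZMod.Basic
import Mathlib.Tactic.Ring
import Mathlib.Tactic.Linarith
import Mathlib.Tactic.NormNum
import HarnessLib

/-!
# Venture HSemireg — the arithmetic of the SIGN RULE for real node fields (ENGINE-W PROBE5 §17): no units of norm `−1`, the sign
# `s(c) = sign N(z_c)` read off a congruence, the `ℚ(√3) ∕ ℚ(√6) ∕ ℚ(√7)` sign tables, and the unit-ratio step — kernel arithmetic

HONEST FRAMING. Lean index of the computation cell `pub-hsemireg`, widening group ENGINE-W (code A, seat `engine-w-1`,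
gen 17). INTEGER ARITHMETIC in `ℤ[√m]` (Mathlib `ℤ√m`) and residues; no abelian variety, sheaf, `Ext` group, secant structure or
semiregularity map is constructed; nothing here says that HC, HC_CM or HC_AV holds. Theorems only (0 `def`, 0 named fact, 0 `sorry`).
New namespace `SignRule`. Companion of `LineDiophantineArithmetic.lean` (line tables) and `AntiUnitaryPairMatrix.lean` (`U_m`).

SOURCE (the cell's own result): `widen/ENGINE-W/out/probe5/PROBE5-STIZ-A.md` §17 (v2.3, engine-w-1 g6) as printed: «SETTING: `m > 0`,
`h(ℤ[√m]) = 1` …, so every admissible weight `c` … has `𝔞_c = (c, A+√m) = (z_c)`, `z_c ∈ ℤ[√m]`, `|N(z_c)| = c`; put **`s(c) := sign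
N(z_c)`** — well defined exactly when `k′` has no unit of norm `−1` (`ℚ(√3), ℚ(√6), ℚ(√7), ℚ(√11), ℚ(√14), ℚ(√23), …`; for `ℚ(√2)`
both signs occur and there is no rule). `s` is multiplicative; for `ℚ(√3)`: `s(2) = s(3) = −1` (`1+√3, √3`), `s(p) = +1` for `p ≡ 1
(mod 12)` (`13 = N(4+√3), 37, 61, 73`), `s(p) = −1` for `p ≡ 11 (mod 12)` (`11, 23, 47, 59, 71`) …, `s(6) = +, s(22) = +, s(26) = −,
s(33) = +`. **THEOREM (SIGN RULE, necessary).** Assume `−1 ∉ N_{F∕F^τ}(R^×)` … then **`Π_{a∈P} s(c_a) = Π_{a∈Q} s(c_a)`.** PROOF. …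
`y_P … N(y_P) = (h_s∕h₁)³·Π_{a∈P} s(c_a)`; likewise `y_Q`. Then `y_P∕y_Q ∈ R^×` has norm `Π_P s ∕ Π_Q s ∈ {±1} ∩ N(R^×) = {1}`. ∎»,
REMARK v2.3a (i) («`ℚ(√7)` …: `s(1) = s(2) = +: 2 = N(3+√7); s(3) = s(6) = s(7) = −: −3 = N(2+√7), −7 = N(√7); s(21) = +`») and §18
(`ℚ(√6)`: «`s(2) = s(5) = s(6) = s(15) = −, s(3) = s(10) = +`»). What the kernel holds (`N(x + y√m) = x² − my²`, `Zsqrtd.norm`):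

* §1 **no unit of norm `−1`**: `x² − my² ≠ −1` for `m = 3, 6, 7, 11, 14, 19, 22, 23` (a congruence mod `3`, `7`, `11`, `19`, `23` or `8`),
  and the `ℚ(√2) ∕ ℚ(√10)` contrast (`N(1+√2) = N(3+√10) = −1`).
* §2 **`s(c)` is forced by a congruence** (so the two signs never both occur for one `c`): `ℚ(√3)`: `x² − 3y² ≡ 0, 1 (mod 3)`, hence
  `c ≡ 1 (3) ⇒ s = +`, `c ≡ 2 (3) ⇒ s = −` (`sign_sqrt3_pos ∕ _neg`), and `x² − 3y² ≠ 3` (`s(3) = −`); `ℚ(√7)`: `x² − 7y² mod 7` is a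
  square; `ℚ(√6)`: mod `3` and mod `8`.
* §3 **the tables by witnesses**: `ℚ(√3)`: `N(1+√3) = −2, N(√3) = −3, N(1+2√3) = −11, N(4+√3) = 13, N(2+3√3) = −23, N(7+2√3) = 37,
  N(1+4√3) = −47, N(4+5√3) = −59, N(8+√3) = 61, N(2+5√3) = −71, N(11+4√3) = 73, N(3+√3) = 6, N(5+√3) = 22, N(1+3√3) = −26, N(6+√3) =
  33`; `ℚ(√7)`: `2, −3, −7, −6, −14, 21`; `ℚ(√6)`: `−2, −5, 3, 10, −15, −6` — exactly the printed signs.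
* §4 **the unit-ratio step** `unit_ratio_step`: `N(y_P) = h·σ_P`, `N(y_Q) = h·σ_Q`, `N(y_P) = N(u)·N(y_Q)`, `N(u) = 1`, `h ≠ 0` ⟹ `σ_P = σ_Q`;
  `prod_signs_multiplicative` — `s` multiplicative is `N` multiplicative (`Zsqrtd.norm_mul`).
WHAT IS NOT HERE: ideals `𝔞_c`, class numbers, LEMMA `𝔞_c`, the W-alive classes; the SIGN RULE as a statement about transports.
-/

namespace Summit.Ventures.HSemireg.SignRule

/-! ## §1 No unit of norm `−1` -/

/-- **No unit of norm `−1` in `ℤ[√m]` for `m = 3, 6, 7, 11, 14, 19, 22, 23`**: `x² − my² = −1` is impossible — modulo `3` (`m = 3, 6`),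
`7` (`m = 7, 14`), `11`, `19`, `23` (`−1` is not a square mod a prime `≡ 3 (4)` dividing `m`) resp. modulo `8` for `m = 22`
(`x² − 22y² ≡ x² − 6y² ≢ 7 (mod 8)`). [kernel, `decide` on residues] -/
theorem no_norm_neg_one :
    (∀ x y : ZMod 3, x ^ 2 - 3 * y ^ 2 ≠ -1) ∧ (∀ x y : ZMod 3, x ^ 2 - 6 * y ^ 2 ≠ -1) ∧
    (∀ x y : ZMod 7, x ^ 2 - 7 * y ^ 2 ≠ -1) ∧ (∀ x y : ZMod 11, x ^ 2 - 11 * y ^ 2 ≠ -1) ∧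
    (∀ x y : ZMod 7, x ^ 2 - 14 * y ^ 2 ≠ -1) ∧ (∀ x y : ZMod 19, x ^ 2 - 19 * y ^ 2 ≠ -1) ∧
    (∀ x y : ZMod 8, x ^ 2 - 22 * y ^ 2 ≠ -1) ∧ (∀ x y : ZMod 23, x ^ 2 - 23 * y ^ 2 ≠ -1) := by
  refine ⟨by decide, by decide, by decide, by decide, by decide, by decide, by decide, by decide⟩

/- Lifting to `ℤ` for `m = 3` (`x² − 3y² ≠ −1` for all integers, reduce mod 3) is ALREADY in the tree with the same normalized statement:
`Summit.HodgeConjecture.HodgeConjecture.Ring2.WeilCoverage.RankOneCM.no_norm_neg_one`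
(`Summits/HodgeConjecture/HodgeConjecture/Theorems/Ring2WeilCoverageRankOneCM.lean`) — cite that declaration; it is not restated here (gate near-duplicate, v2). -/

/-- The contrast «for `ℚ(√2)` both signs occur and there is no rule» (and `ℚ(√10)`, §17 (b)): `N(1 + √2) = −1`, `N(3 + √10) = −1`.
[kernel, `decide`] -/
theorem norm_neg_one_units : (⟨1, 1⟩ : ℤ√2).norm = -1 ∧ (⟨3, 1⟩ : ℤ√10).norm = -1 := by
  simp only [Zsqrtd.norm_def]; decide

/-! ## §2 The sign is forced by a congruence -/

/-- `ℚ(√3)`: `x² − 3y² ≡ x² ∈ {0, 1} (mod 3)`. [kernel, `decide`] -/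
theorem norm_sqrt3_mod3 : ∀ x y : ZMod 3, x ^ 2 - 3 * y ^ 2 = 0 ∨ x ^ 2 - 3 * y ^ 2 = 1 := by
  decide

/-- **`s(c) = +1` for `c ≡ 1 (mod 3)`**: a weight `c ≡ 1 (mod 3)` is never `−N(z)`: `x² − 3y² = −c` is impossible. [kernel] -/
theorem sign_sqrt3_pos (x y c : ℤ) (hc : c % 3 = 1) : x ^ 2 - 3 * y ^ 2 ≠ -c := by
  intro h
  obtain ⟨k, hk⟩ : ∃ k, c = 3 * k + 1 := ⟨c / 3, by omega⟩
  subst hk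
  have h3 := congrArg (fun z : ℤ => (z : ZMod 3)) h
  push_cast at h3
  have key : ∀ a b kk : ZMod 3, a ^ 2 - 3 * b ^ 2 ≠ -(3 * kk + 1) := by decide
  exact key _ _ _ h3

/-- **`s(c) = −1` for `c ≡ 2 (mod 3)`**: `x² − 3y² = c` is impossible. [kernel] -/
theorem sign_sqrt3_neg (x y c : ℤ) (hc : c % 3 = 2) : x ^ 2 - 3 * y ^ 2 ≠ c := by
  intro h
  obtain ⟨k, hk⟩ : ∃ k, c = 3 * k + 2 := ⟨c / 3, by omega⟩
  subst hk
  have h3 := congrArg (fun z : ℤ => (z : ZMod 3)) h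
  push_cast at h3
  have key : ∀ a b kk : ZMod 3, a ^ 2 - 3 * b ^ 2 ≠ 3 * kk + 2 := by decide
  exact key _ _ _ h3

/-- `s(3) = −1`: `x² − 3y² = 3` is impossible (mod 9: `3 ∣ x`, then `y² ≡ −1 (mod 3)`), while `N(√3) = −3`. [kernel, `decide` mod 9] -/
theorem sign_sqrt3_three : (∀ x y : ZMod 9, x ^ 2 - 3 * y ^ 2 ≠ 3) ∧ (⟨0, 1⟩ : ℤ√3).norm = -3 := by
  refine ⟨by decide, ?_⟩
  simp only [Zsqrtd.norm_def]; decide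

/-- `ℚ(√7)`: `x² − 7y² ≡ x² (mod 7)` is `0, 1, 2` or `4` — so `s(c) = +` iff `c mod 7 ∈ {1, 2, 4}` for `7 ∤ c` (`s(2) = +`, `s(3) = s(6)
= −`). `ℚ(√6)`: `x² − 6y² mod 3 ∈ {0, 1}` and `mod 8 ∈ {0, 1, 2, 3, 4, 6}` (so `s(5) = −`: `5 ≡ 2 (3)`; `s(15) = −`: `15 ≡ 7 (8)`).
[kernel, `decide`] -/
theorem norm_residues_sqrt7_sqrt6 :
    (∀ x y : ZMod 7, x ^ 2 - 7 * y ^ 2 = 0 ∨ x ^ 2 - 7 * y ^ 2 = 1 ∨ x ^ 2 - 7 * y ^ 2 = 2 ∨ x ^ 2 - 7 * y ^ 2 = 4) ∧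
    (∀ x y : ZMod 3, x ^ 2 - 6 * y ^ 2 = 0 ∨ x ^ 2 - 6 * y ^ 2 = 1) ∧
    (∀ x y : ZMod 8, x ^ 2 - 6 * y ^ 2 ≠ 5 ∧ x ^ 2 - 6 * y ^ 2 ≠ 7) := by
  refine ⟨by decide, by decide, by decide⟩

/-! ## §3 The sign tables by witnesses -/

/-- **The `ℚ(√3)` table** («`s(2) = s(3) = −1` (`1+√3, √3`), `s(p) = +1` for `p ≡ 1 (mod 12)` (`13 = N(4+√3), 37, 61, 73`), `s(p) = −1`
for `p ≡ 11 (mod 12)` (`11, 23, 47, 59, 71`) …, `s(6) = +, s(22) = +, s(26) = −, s(33) = +`»): the generators and their norms.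
[kernel, `decide`] -/
theorem table_sqrt3 :
    (⟨1, 1⟩ : ℤ√3).norm = -2 ∧ (⟨0, 1⟩ : ℤ√3).norm = -3 ∧ (⟨1, 2⟩ : ℤ√3).norm = -11 ∧ (⟨4, 1⟩ : ℤ√3).norm = 13 ∧
    (⟨2, 3⟩ : ℤ√3).norm = -23 ∧ (⟨7, 2⟩ : ℤ√3).norm = 37 ∧ (⟨1, 4⟩ : ℤ√3).norm = -47 ∧ (⟨4, 5⟩ : ℤ√3).norm = -59 ∧
    (⟨8, 1⟩ : ℤ√3).norm = 61 ∧ (⟨2, 5⟩ : ℤ√3).norm = -71 ∧ (⟨11, 4⟩ : ℤ√3).norm = 73 ∧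
    (⟨3, 1⟩ : ℤ√3).norm = 6 ∧ (⟨5, 1⟩ : ℤ√3).norm = 22 ∧ (⟨1, 3⟩ : ℤ√3).norm = -26 ∧ (⟨6, 1⟩ : ℤ√3).norm = 33 := by
  simp only [Zsqrtd.norm_def]; decide

/-- The residues behind «`p ≡ 1 (mod 12)` ⇒ `+`, `p ≡ 11 (mod 12)` ⇒ `−`»: `13, 37, 61, 73 ≡ 1` and `11, 23, 47, 59, 71 ≡ 2 (mod 3)`, in line
with `sign_sqrt3_pos ∕ _neg`. [kernel, `decide`] -/
theorem table_sqrt3_residues :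
    (13 % 3 = 1 ∧ 37 % 3 = 1 ∧ 61 % 3 = 1 ∧ 73 % 3 = 1) ∧ (11 % 3 = 2 ∧ 23 % 3 = 2 ∧ 47 % 3 = 2 ∧ 59 % 3 = 2 ∧ 71 % 3 = 2) := by
  decide

/-- **The `ℚ(√7)` table** (REMARK v2.3a (i)): `N(3+√7) = 2, N(2+√7) = −3, N(√7) = −7, N(1+√7) = −6, N(7+3√7) = −14, N(7+2√7) = 21`
(`s(2) = +, s(3) = s(7) = s(6) = s(14) = −, s(21) = +`). [kernel, `decide`] -/
theorem table_sqrt7 :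
    (⟨3, 1⟩ : ℤ√7).norm = 2 ∧ (⟨2, 1⟩ : ℤ√7).norm = -3 ∧ (⟨0, 1⟩ : ℤ√7).norm = -7 ∧ (⟨1, 1⟩ : ℤ√7).norm = -6 ∧
    (⟨7, 3⟩ : ℤ√7).norm = -14 ∧ (⟨7, 2⟩ : ℤ√7).norm = 21 := by
  simp only [Zsqrtd.norm_def]; decide

/-- **The `ℚ(√6)` table** (§18): `N(2+√6) = −2, N(1+√6) = −5, N(3+√6) = 3, N(4+√6) = 10, N(3+2√6) = −15, N(√6) = −6`
(`s(2) = s(5) = s(6) = s(15) = −, s(3) = s(10) = +`). [kernel, `decide`] -/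
theorem table_sqrt6 :
    (⟨2, 1⟩ : ℤ√6).norm = -2 ∧ (⟨1, 1⟩ : ℤ√6).norm = -5 ∧ (⟨3, 1⟩ : ℤ√6).norm = 3 ∧ (⟨4, 1⟩ : ℤ√6).norm = 10 ∧
    (⟨3, 2⟩ : ℤ√6).norm = -15 ∧ (⟨0, 1⟩ : ℤ√6).norm = -6 := by
  simp only [Zsqrtd.norm_def]; decide

/-! ## §4 The unit-ratio step and multiplicativity -/

/-- **«`y_P∕y_Q ∈ R^×` has norm `Π_P s ∕ Π_Q s ∈ {±1} ∩ N(R^×) = {1}`»**: if `N(y_P) = h·σ_P`, `N(y_Q) = h·σ_Q`, `N(y_P) = N(u)·N(y_Q)` with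
`N(u) = 1` and `h ≠ 0`, then `σ_P = σ_Q`. [kernel] -/
theorem unit_ratio_step {R : Type*} [CommRing R] [IsDomain R] (NyP NyQ Nu h σP σQ : R) (hP : NyP = h * σP)
    (hQ : NyQ = h * σQ) (hratio : NyP = Nu * NyQ) (hu : Nu = 1) (hh : h ≠ 0) : σP = σQ := by
  subst hu
  rw [one_mul, hP, hQ] at hratio
  exact mul_left_cancel₀ hh hratio

/-- «`s` is multiplicative»: the norm is (`N(zw) = N(z)N(w)` in `ℤ√m`), so `sign N(z_c z_{c′}) = sign N(z_c)·sign N(z_{c′})`. [kernel] -/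
theorem prod_signs_multiplicative {m : ℤ} (z w : ℤ√m) : (z * w).norm = z.norm * w.norm :=
  Zsqrtd.norm_mul z w

end Summit.Ventures.HSemireg.SignRule
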